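import Literature.MathematicalPhysics.QuantumFieldTheory.Balaban1983to89.B8Thm2TorusKnitMajorantsOfSite
import Literature.MathematicalPhysics.QuantumFieldTheory.Balaban1983to89.B9B8KnitLetterE12FromM55
import Literature.MathematicalPhysics.QuantumFieldTheory.Balaban1983to89.B9B8KnitLetterE12GradFromM55

/-!
# `Balaban1983to89.B8Thm2TorusKnitMajorantsOfCubes` — M5.9 ASSEMBLY, FILE A8: file A4's displayed majorant package `KnitMajorants` with ALL THREE entries
# read off the cube packages — (3.42)₁ `hGm` from junction file 15 (`B9B8KnitLetterE12FromM55.hasMajorant_conj_GpY_parKnitY_of_cubes`), (3.42)₂ `hDG` from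
# junction file 16 (`B9B8KnitLetterE12GradFromM55.hasMajorant_left_conj_GpY_parKnitY_of_cubes`, left factor `conj b(η_S⁻¹∇_{U,μ})`, weight `ℓ`), (3.48) `hC`
# from file A7 (`B8Thm2TorusKnitMajorantsOfSite.knitMajorants_of_site`, junction file 20) — the per-(member, background) inputs packaged as ONE record
# `KnitCubeInputs` = [Balaban1985BackgroundPropagators] Thm 3.7's cube data at def-Y's letter of record + Thm 3.9's per-cube data at print's transporters,
# the member-free scalars as ONE record `KnitCubeParams` with its side conditions `KnitCubeParams.Valid`

statement-level skeleton of published theorems with citation tags; proofs where landed; nothing here is a claim about the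
Yang–Mills mass gap

T. Bałaban, *Propagators for lattice gauge theories in a background field*, Commun. Math. Phys. **99** (1985) 389–434 [`Balaban1985BackgroundPropagators`, "[4]"]:
Thm 3.1 (3.42) p. 397, Thm 3.2 (3.48) p. 398, Thm 3.7 (3.87)–(3.90) pp. 409–410, Thm 3.9 p. 413, (3.95)–(3.96) p. 411, (3.19) p. 393, (3.24)–(3.25) p. 394.
T. Bałaban, *Propagators and renormalization transformations for lattice gauge theories. II*, Commun. Math. Phys. **96** (1984) 223–250 [`Balaban1984PropagatorsII`]:
Lemma 2.1 (2.61)–(2.63) p. 234, Prop. 2.2 (2.64)–(2.67) p. 234, (2.52)–(2.54) p. 232, (2.83) p. 237.  T. Bałaban, *Spaces of regular gauge field configurations on a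
lattice and gauge fixing conditions*, Commun. Math. Phys. **99** (1985) 75–102 [`Balaban1985RegularSpaces`]: (1.91)–(1.98) pp. 91–92, (1.101) p. 93, (1.7) p. 77.
T. Bałaban, *Averaging operations for lattice gauge theories*, Commun. Math. Phys. **98** (1985) 17–51 [`Balaban1985Averaging`]: Prop. 2 p. 26, (52) p. 26.
STATUS: published, refereed.

THE PRINT.  [4] p. 410: *«Theorem 3.1 follows simply from Corollary 3.6 holding for all G′_□, □ ∈ 𝒟, from the bound (3.89) and Lemma 2.1»* (of
[Balaban1984PropagatorsII]) — the random-walk expansion (3.87)–(3.90) over a cube cover; p. 413 Thm 3.9 ∕ (3.95)–(3.96) p. 411 — the same expansion for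
`(Q′G′²Q′*)⁻¹`, giving Thm 3.2 (3.48).  The consumer ([Balaban1985RegularSpaces] Thm 2, Prop. 5) reads the three conclusions as (1.101) ∕ (1.98).

WHY THIS FILE ∕ THE ARGUMENT.  File A7 (`knitMajorants_of_site`) produced file A4's `KnitMajorants i U b ιB …` from (a) a (3.42)₁-shape SITE majorant `hGm` of
`η_S²G′(U; parKnitY)`, (b) (3.42)₂-shape site majorants `hDG μ`, (c) M5.6's per-cube data (junction file 20).  Junction files 15 ∕ 16 (seat p33) produce exactly
(a) ∕ (b) from M5.5's CUBE data at def-Y's letter of record `parSymY` — cube terms `T_□`, remainders `R_□`, (3.88) `Δ′_a·ΣT_□ = 1 − ΣR_□`, Cor.-3.6 block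
majorants of `conj b(η²T_□)` and their left entries `K_{E,□}`, (3.89) majorants of `conj b R_□`, overlap counts, two instances of Lemma 2.1 — by APPLICATION.
This file composes the three (plus `B6RandomWalk.hasMajorant_mono` to the common amplitude `A` and rate `δ_G` of (c)), so that what stays displayed at one
member and one background is named ONLY in the output shapes of sub-row G-B9-LETTERS' located suppliers M5.1b∕c (cube letters), M5.2 (local inverse
property), M5.4 (commutator sizes), M5.5 (Thm 3.7 cube data), M5.6 (Thm 3.9 per-cube data) and the [4] §2 geometry of the member's block set.

CITATION HEADER (lean-in-tree rule).  Cell `lit-balaban`, seat `lit-balaban-t2s-1` (gen 5), MODULE M5.9, file A8; sub-row G-B8-T2S (R3 `stmt-QuantumFields-19200`,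
helper).  CONSUMED BY NAME: junction J-B files 15 (`hasMajorant_conj_GpY_parKnitY_of_cubes`), 16 (`hasMajorant_left_conj_GpY_parKnitY_of_cubes`) of seat p33
gen 94 (+ file 15's `inv_factor_nonneg`); file A7 `knitMajorants_of_site` (seat t2s-1 gen 4); `B6RandomWalk.hasMajorant_mono`, `c1_nonneg`; file A4's `KnitMajorants`,
`KnitConstants`.

WHAT THIS FILE DECLARES ∕ PROVES (sorry-free).
* §1 `KnitCubeParams` — the MEMBER- AND BACKGROUND-FREE scalars of the two cube expansions (M5.5: `dG₁ dG₂ δG₀ αG₁ θG BG₀ NG NG′ αG₂ A_E α₀′`; M5.6: file A7's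
  `d′ d₂ A δ_G α_G α₂ C_G δ₀ a_L a_D α_c α_st a_sep ρ b κ_D D_sep ℓ₀ ℓ₁ B₀ C N α′`; final resummation `d₁ ε₀ βₓ ρ_f δ`), with the DERIVED amplitudes
  `A₁G` (M5.5's `N B₀c₁(1 − N′θc₁)⁻¹`), `θtr` (junction file 9's `32(d+1)²α₀′(M₂Σ‖b_j‖)A₁G`), `rG` (`(1−α₂)(1−α₁)δ₀`), `AG` (file 15's output amplitude), `AD`
  (file 16's), `κG θ₁ θ₂ θ₃ KC` (file A7's); `KnitCubeParams.Valid` — every sign ∕ smallness ∕ split condition of files 15, 16, A7 on those scalars, plus the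
  two couplings `AG ≤ A`, `δ_G ≤ rG` and the final-rate budget of file A4's `KnitConstants`; `A₁G_nonneg`, `AD_nonneg`, `KC_nonneg`, ★ `knitConstants_of_valid`
  (file A4's uniform constants `KnitConstants b M₂ ε₀ δ βₓ ρ_f A AD KC` hold under `Valid`).
* §2 `KnitCubeInputs i U b ιB Rr Hp p c s` — the per-(member, background) DATA and LAWS: M5.5's cube data at `parSymY` (index type `κ`, supports `S, S′`, cube
  terms `T`, remainders `R`, left entries `K_E μ`, the laws `hT`, `h389`, `h388`, `hTE`, `hKE`, overlap counts), M5.6's per-cube data at `parKnitY` VERBATIM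
  (file A7's list: cube letters `Oc`, cut-offs `h, χ`, supports, local inverses `Cl`, `hloc`, `hC`, `hD`, `hGc`, separation, slow variation), the member's
  section `ιB`, scale `c_f = Lᵏ`, unit `s`, row sum `c`, and the [4] §2 geometry (2.54) ∕ (2.61) ∕ (2.63) ∕ scale transfers at the rates used.
* §3 ★★★ **`knitMajorants_of_cubes`** — `G ≤ U(N)` averaging-closed, `N ≥ 1`, a `G`-valued `U` with `G`-valued knit legs and `pdev (liftCfg U) < α₀′L^{−2k}`
  ([Balaban1985Averaging] (52) at the member's finest scale), `p.Valid`, `KnitCubeInputs i U b ιB Rr Hp p c s` ⟹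
  `KnitMajorants i U b ιB Rr Hp p.d₁ p.ε₀ p.δ p.βₓ p.ρ_f p.A (p.AD d b M₂) (p.KC b M₂) c s`.

HONEST SCOPE.  Plumbing only (composition + rate∕amplitude weakening); NO estimate of [4] or [Balaban1985RegularSpaces] is proved: the cube data of Thm 3.7 ∕
Thm 3.9 (Cor. 3.6 at the cube letters, (3.89), (3.88), the local inverse property, the [2]-difference majorants `hD` = GAP G-B9-05), the geometry and the
smallness conditions are DISPLAYED fields of `KnitCubeInputs` ∕ `KnitCubeParams.Valid`, inhabited by nothing here; count-neutral; N05 ∕ `stub_PV3A` NOT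
discharged; nothing continuum ∕ ℝ⁴ ∕ OS ∕ mass-gap ∕ Clay — the Yang–Mills mass gap is NOT proved.  No `sorry`, no `axiom`, no `… : Prop` fact (the two
`structure … : Prop`∕`Type` records are hypothesis SHAPES with all fields displayed, in the style of file A4's `KnitMajorants`), no `instance`, no `notation`.
NEW file; nothing landed is modified.  Seat `lit-balaban-t2s-1` gen 5, 2026-08-28.
-/

noncomputable section

open scoped BigOperators

namespace Literature.MathematicalPhysics.QuantumFieldTheory.Balaban1983to89.B8Thm2TorusKnitMajorantsOfCubes

open Node00 B6KLevelCensusIndexV1 B6Geom246MultiLevelBox B9BackgroundsKLevelV1 B9Eq39Adjoint B9Thm311ReadingCoords B9Thm311DeltaPrimePos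
open B6RandomWalk (HasMajorant Triangle254 Ineq261 Ineq263 hasMajorant_mono c1_nonneg)
open B9Thm34Ext (toB6)
open B9GeoNormsKLevelV1 (geo9K geo9K_len_kGeo)
open B9Eq352DivFormLetters (conj)
open B9Eq352GradLetters (diffLetter)
open B9Thm37CubeCoverCommutators (cutMulY)
open B7Prop2Explicit (AvgClosed pdev C0 c2')
open B9B8CarrierDictionary (liftCfg)
open B9B8AveragingJunction (parKnitY)
open B9B8KnitLetterE12FromM55 (hasMajorant_conj_GpY_parKnitY_of_cubes inv_factor_nonneg)
open B9B8KnitLetterE12GradFromM55 (hasMajorant_left_conj_GpY_parKnitY_of_cubes)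
open B8Thm2TorusKnitEstimatesOfMajorants (KnitConstants KnitMajorants)
open B8Thm2TorusKnitMajorantsOfSite (knitMajorants_of_site)
open scoped Matrix Matrix.Norms.L2Operator

variable {d ℓ : ℕ} {hd : 1 ≤ d + 1} {hL : Odd (ℓ + 1) ∧ 1 < ℓ + 1} {b₀ b₁ : ℝ}

/-! ## §1 The member-free scalars of the two cube expansions and their side conditions -/

section Params

/-- **THE MEMBER- AND BACKGROUND-FREE SCALARS OF THE CUBE PACKAGES** (a data record; no law): the dimensions of the three∕four [Balaban1984PropagatorsII]
Lemma 2.1 instances, M5.5's Thm 3.7 constants (`δG₀` base rate, `αG₁` first exponent, `θG` the (3.89) constant, `BG₀` the Cor.-3.6 constant of the cube terms,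
`NG, NG′` overlap counts, `αG₂` the transfer exponent, `AE` the left-entry constant, `α₀′` the (52)-flatness of the background at the member's finest scale),
file A7's M5.6 constants (names as there), and the final resummation data of file A4 (`d₁ ε₀ βₓ ρ_f δ`).
[cite: Balaban1985BackgroundPropagators, Thm 3.7 (3.87)–(3.90) pp.409–410, Thm 3.9 p.413, (3.95)–(3.96) p.411; Balaban1984PropagatorsII, Lemma 2.1 (2.61)–(2.63) p.234, (2.66)–(2.67) p.234] -/
structure KnitCubeParams where
  /-- Lemma 2.1 dimension of M5.5's cube walk. -/
  dG₁ : ℕ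
  /-- Lemma 2.1 dimension of the `parSymY → parKnitY` transfer. -/
  dG₂ : ℕ
  /-- M5.5: base rate `δ₀` of Thm 3.7's cube data. -/
  δG₀ : ℝ
  /-- M5.5: first Lemma-2.1 exponent `α₁`. -/
  αG₁ : ℝ
  /-- M5.5: the (3.89) constant `θ`. -/
  θG : ℝ
  /-- M5.5: the Cor.-3.6 constant `B₀` of the cube terms. -/
  BG₀ : ℝ
  /-- M5.5: overlap count `N` of the cube supports. -/
  NG : ℝ
  /-- M5.5: overlap count `N′` of the remainder supports. -/
  NG' : ℝ
  /-- transfer: second Lemma-2.1 exponent `α₂`. -/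
  αG₂ : ℝ
  /-- M5.5 left entries: the constant `A_E` of `ΣK_{E,□} ≤ A_E·ℓ·e^{−δ₀d}`. -/
  AE : ℝ
  /-- the (52)-flatness constant `α₀′` at the member's finest scale. -/
  α₀' : ℝ
  /-- file A7: Lemma 2.1 dimension `d′`. -/
  d' : ℕ
  /-- file A7: Lemma 2.1 dimension `d₂` of the `G`-part. -/
  d₂ : ℕ
  /-- file A7: common amplitude `A` of the (3.42)₁ site majorants of `η²G′` and of the cube letters. -/
  A : ℝ
  /-- file A7: their common rate `δ_G`. -/
  δG : ℝ
  /-- file A7: scale-transfer exponent `α_G`. -/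
  αG : ℝ
  /-- file A7: exponent `α₂` of the `G`-part's Lemma 2.1. -/
  α₂ : ℝ
  /-- file A7: scale-transfer constant `C_G`. -/
  CG : ℝ
  /-- file A7: base rate `δ₀` of M5.6. -/
  δ₀ : ℝ
  /-- file A7: exponent `a_L`. -/
  aL : ℝ
  /-- file A7: exponent `a_D`. -/
  aD : ℝ
  /-- file A7: exponent `α_c`. -/
  αc : ℝ
  /-- file A7: exponent `α_st`. -/
  αst : ℝ
  /-- file A7: exponent `a_sep`. -/
  asep : ℝ
  /-- file A7: final exponent `ρ` of M5.6. -/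
  ρ : ℝ
  /-- file A7: exponent `b` of the per-cube (3.48) blocks. -/
  bb : ℝ
  /-- file A7: the [2]-difference constant `κ_D`. -/
  κD : ℝ
  /-- file A7: separation `D_sep`. -/
  Dsep : ℝ
  /-- file A7: slow variation `ℓ₀`. -/
  ℓ₀ : ℝ
  /-- file A7: slow variation `ℓ₁`. -/
  ℓ₁ : ℝ
  /-- file A7: the per-cube (3.48) constant `B₀`. -/
  B₀ : ℝ
  /-- file A7: scale-transfer constant `C` of `ℓ⁻⁴`. -/
  C : ℝ
  /-- file A7: overlap count `N` of M5.6's cover. -/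
  Nn : ℝ
  /-- file A7: exponent `α′` of the last Lemma 2.1. -/
  α' : ℝ
  /-- file A4: Lemma 2.1 dimension `d₁` of the final resummation. -/
  d₁ : ℕ
  /-- file A4: its rate `ε₀`. -/
  ε₀ : ℝ
  /-- file A4: its exponent `βₓ`. -/
  βx : ℝ
  /-- file A4: the final row-sum rate `ρ_f`. -/
  ρf : ℝ
  /-- file A4: the common rate `δ` of the three majorants. -/
  δ : ℝ

namespace KnitCubeParams

variable (p : KnitCubeParams)

/-- M5.5's amplitude `A₁ = N B₀c₁(α₁)(1 − N′θc₁(α₁))⁻¹` of `conj b(η²G′(U; parSymY))` (junction file 15's `A₁`).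
[cite: Balaban1985BackgroundPropagators, Thm 3.7 (3.90) p.410; Balaban1984PropagatorsII, (2.66)–(2.67) p.234] -/
def A₁G : ℝ := p.NG * p.BG₀ * B6.c1 p.dG₁ p.δG₀ p.αG₁ * (1 - p.NG' * p.θG * B6.c1 p.dG₁ p.δG₀ p.αG₁)⁻¹

/-- the transfer's small constant `θ₂ = 32(d+1)²α₀′(M₂Σ‖b_j‖)A₁` (junction file 9). [cite: Balaban1985BackgroundPropagators, (3.90) p.410; Balaban1984PropagatorsII, (2.66) p.234] -/
def θtr (d : ℕ) {N : ℕ} {ι : Type} [Fintype ι] (b : Module.Basis ι ℝ (Matrix (Fin N) (Fin N) ℂ)) (M₂ : ℝ) : ℝ :=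
  32 * ((d : ℝ) + 1) ^ 2 * p.α₀' * (M₂ * ∑ j, ‖b j‖) * p.A₁G

/-- the rate `(1−α₂)(1−α₁)δ₀` of junction files 15∕16's outputs. [cite: Balaban1985BackgroundPropagators, p.410 («decay rate arbitrarily close»)] -/
def rG : ℝ := (1 - p.αG₂) * ((1 - p.αG₁) * p.δG₀)

/-- junction file 15's output amplitude `A₁c₁(α₂)(1 − θ₂c₁(α₂))⁻¹`. [cite: Balaban1985BackgroundPropagators, Thm 3.1 (3.42) p.397, (3.90) p.410] -/
def AG (d : ℕ) {N : ℕ} {ι : Type} [Fintype ι] (b : Module.Basis ι ℝ (Matrix (Fin N) (Fin N) ℂ)) (M₂ : ℝ) : ℝ :=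
  p.A₁G * B6.c1 p.dG₂ ((1 - p.αG₁) * p.δG₀) p.αG₂ * (1 - p.θtr d b M₂ * B6.c1 p.dG₂ ((1 - p.αG₁) * p.δG₀) p.αG₂)⁻¹

/-- junction file 16's output amplitude `A_E c₁(α₁)(1 − N′θc₁(α₁))⁻¹·(1 + c₁(α₂)θ₂c₁(α₂)(1 − θ₂c₁(α₂))⁻¹)`.
[cite: Balaban1985BackgroundPropagators, Thm 3.1 (3.42) p.397; Balaban1984PropagatorsII, Prop 2.2 (2.64)–(2.67) p.234] -/
def AD (d : ℕ) {N : ℕ} {ι : Type} [Fintype ι] (b : Module.Basis ι ℝ (Matrix (Fin N) (Fin N) ℂ)) (M₂ : ℝ) : ℝ :=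
  (p.AE * B6.c1 p.dG₁ p.δG₀ p.αG₁ * (1 - p.NG' * p.θG * B6.c1 p.dG₁ p.δG₀ p.αG₁)⁻¹)
    * (1 + B6.c1 p.dG₂ ((1 - p.αG₁) * p.δG₀) p.αG₂
        * (p.θtr d b M₂ * B6.c1 p.dG₂ ((1 - p.αG₁) * p.δG₀) p.αG₂ * (1 - p.θtr d b M₂ * B6.c1 p.dG₂ ((1 - p.αG₁) * p.δG₀) p.αG₂)⁻¹))

/-- file A7's `κ_G = A²C_Gc₁`. [cite: Balaban1984PropagatorsII, (2.83) p.237, (2.61) p.234] -/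
def κG : ℝ := p.A ^ 2 * p.CG * B6.c1 p.d₂ ((1 - p.αG) * p.δG) p.α₂

/-- file A7's `θ₁`. [cite: Balaban1985BackgroundPropagators, (3.95)–(3.96) p.411; Balaban1984PropagatorsII, (2.83)–(2.85) p.237] -/
def θ₁ {N : ℕ} {ι : Type} [Fintype ι] (b : Module.Basis ι ℝ (Matrix (Fin N) (Fin N) ℂ)) (M₂ : ℝ) : ℝ :=
  p.Nn * (((M₂ * ∑ j, ‖b j‖) ^ 2 * p.κG) * p.B₀ * p.C * B6.c1 p.d' p.δ₀ (p.bb - p.ρ) * Real.exp (-(p.asep * p.δ₀ * p.Dsep)))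

/-- file A7's `θ₂`. [cite: Balaban1985BackgroundPropagators, (3.95)–(3.96) p.411; Balaban1984PropagatorsII, (2.83)–(2.85) p.237] -/
def θ₂ : ℝ := p.Nn * (p.κD * Real.exp (-(2 * p.δ₀ * p.Dsep)) * p.B₀ * p.C * B6.c1 p.d' p.δ₀ (p.bb - p.ρ))

/-- file A7's `θ₃`. [cite: Balaban1985BackgroundPropagators, (3.95)–(3.96) p.411; Balaban1984PropagatorsII, (2.83)–(2.85) p.237] -/
def θ₃ {N : ℕ} {ι : Type} [Fintype ι] (b : Module.Basis ι ℝ (Matrix (Fin N) (Fin N) ℂ)) (M₂ : ℝ) : ℝ :=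
  p.Nn * ((p.ℓ₀ + p.ℓ₁ * (p.αc * p.δ₀)⁻¹) * ((M₂ * ∑ j, ‖b j‖) ^ 2 * p.κG) * p.B₀ * p.C * B6.c1 p.d' p.δ₀ (p.bb - p.ρ))

/-- file A7's output (3.48) amplitude `K = N·B₀·c₁(ρδ₀, α′)·(1 − (θ₁+θ₂+θ₃)c₁(ρδ₀, α′))⁻¹`. [cite: Balaban1985BackgroundPropagators, Thm 3.2 (3.48) p.398, Thm 3.9 p.413] -/
def KC {N : ℕ} {ι : Type} [Fintype ι] (b : Module.Basis ι ℝ (Matrix (Fin N) (Fin N) ℂ)) (M₂ : ℝ) : ℝ :=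
  p.Nn * p.B₀ * B6.c1 p.d' (p.ρ * p.δ₀) p.α' * (1 - (p.θ₁ b M₂ + p.θ₂ + p.θ₃ b M₂) * B6.c1 p.d' (p.ρ * p.δ₀) p.α')⁻¹

/-- **THE SIDE CONDITIONS ON THE SCALARS** (every sign ∕ smallness ∕ exponent-split hypothesis of junction files 15, 16 and file A7 that mentions no member and no
background, the real-coordinate bound `M₂` of the basis `b`, the [Balaban1985Averaging] Prop. 2 thresholds on `α₀′`, the couplings `AG ≤ A`, `δ_G ≤ rG` of the
(3.42)₁ output of file 15 to file A7's common amplitude∕rate, and file A4's final-rate budget `ρ_f + 2βₓε₀ ≤ δ ≤ δ_G, (1−α′)ρδ₀`).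
[cite: Balaban1985BackgroundPropagators, Thm 3.7 p.410, Thm 3.9 p.413, p.391; Balaban1984PropagatorsII, Lemma 2.1 (2.61)–(2.63) p.234, (2.66)–(2.67) p.234; Balaban1985Averaging, Prop. 2 p.26] -/
structure Valid (d ℓ : ℕ) {N : ℕ} {ι : Type} [Fintype ι] (b : Module.Basis ι ℝ (Matrix (Fin N) (Fin N) ℂ)) (M₂ : ℝ) : Prop where
  /-- `M₂ ≥ 0`. -/
  hM₂ : 0 ≤ M₂
  /-- the real coordinates are `M₂`-bounded. -/
  hrepr : ∀ (v : Matrix (Fin N) (Fin N) ℂ) (j : ι), |b.repr v j| ≤ M₂ * ‖v‖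
  /-- `α₀′ > 0`. -/
  hα : 0 < p.α₀'
  /-- [Balaban1985Averaging] Prop. 2 threshold `C₀α₀′ ≤ 1∕3`. -/
  hα3 : C0 (d + 1) * p.α₀' ≤ 1 / 3
  /-- [Balaban1985Averaging] Prop. 2 threshold `2α₀′ ≤ c₂′`. -/
  hα2 : 2 * p.α₀' ≤ c2' (d + 1) (ℓ + 1)
  /-- M5.5: `B₀ ≥ 0`. -/
  hBG₀ : 0 ≤ p.BG₀
  /-- M5.5: `θ ≥ 0`. -/
  hθG : 0 ≤ p.θG
  /-- M5.5: `N ≥ 0`. -/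
  hNG : 0 ≤ p.NG
  /-- M5.5: `N′ ≥ 0`. -/
  hNG' : 0 ≤ p.NG'
  /-- M5.5 left entries: `A_E ≥ 0`. -/
  hAE : 0 ≤ p.AE
  /-- M5.5: `0 ≤ (1−α₁)δ₀`. -/
  hαδ₁ : 0 ≤ (1 - p.αG₁) * p.δG₀
  /-- M5.5: `N′θc₁(α₁) < 1`. -/
  hsmallG₁ : p.NG' * p.θG * B6.c1 p.dG₁ p.δG₀ p.αG₁ < 1
  /-- transfer: `0 ≤ (1−α₂)(1−α₁)δ₀`. -/
  hαδ₂ : 0 ≤ (1 - p.αG₂) * ((1 - p.αG₁) * p.δG₀)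
  /-- transfer: `0 ≤ α₂(1−α₁)δ₀`. -/
  hαδ₂' : 0 ≤ p.αG₂ * ((1 - p.αG₁) * p.δG₀)
  /-- transfer: `θ₂c₁(α₂) < 1`. -/
  hsmallG₂ : p.θtr d b M₂ * B6.c1 p.dG₂ ((1 - p.αG₁) * p.δG₀) p.αG₂ < 1
  /-- coupling: file 15's amplitude is below file A7's common amplitude `A`. -/
  hAG : p.AG d b M₂ ≤ p.A
  /-- coupling: file A7's common rate `δ_G` is below file 15's rate. -/
  hδGr : p.δG ≤ p.rG
  /-- file A7: `A ≥ 0`. -/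
  hA : 0 ≤ p.A
  /-- file A7: `C_G ≥ 0`. -/
  hCG : 0 ≤ p.CG
  /-- file A7: `0 ≤ α_Gδ_G`. -/
  hαGδ : 0 ≤ p.αG * p.δG
  /-- file A7: `0 ≤ α₂`. -/
  hα₂0 : 0 ≤ p.α₂
  /-- file A7: `α₂ ≤ 1`. -/
  hα₂1 : p.α₂ ≤ 1
  /-- file A7: `0 ≤ (1−α_G)δ_G`. -/
  hδG : 0 ≤ (1 - p.αG) * p.δG
  /-- file A7: `a_Lδ₀ ≤ (1−α₂)(1−α_G)δ_G`. -/
  hrate : p.aL * p.δ₀ ≤ (1 - p.α₂) * ((1 - p.αG) * p.δG)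
  /-- file A7: `κ_D ≥ 0`. -/
  hκD : 0 ≤ p.κD
  /-- file A7: `ℓ₀ ≥ 0`. -/
  hℓ₀ : 0 ≤ p.ℓ₀
  /-- file A7: `ℓ₁ ≥ 0`. -/
  hℓ₁ : 0 ≤ p.ℓ₁
  /-- file A7: `B₀ ≥ 0`. -/
  hB₀ : 0 ≤ p.B₀
  /-- file A7: `C ≥ 0`. -/
  hC0 : 0 ≤ p.C
  /-- file A7: `N ≥ 0`. -/
  hN : 0 ≤ p.Nn
  /-- file A7: `δ₀ ≥ 0`. -/
  hδ₀ : 0 ≤ p.δ₀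
  /-- file A7: `a_sep ≥ 0`. -/
  hasep : 0 ≤ p.asep
  /-- file A7: `ρ ≥ 0`. -/
  hρ : 0 ≤ p.ρ
  /-- file A7: `ρ ≤ b`. -/
  hρb : p.ρ ≤ p.bb
  /-- file A7: `0 < α_cδ₀`. -/
  hαc : 0 < p.αc * p.δ₀
  /-- file A7: `α′ ≤ 1`. -/
  hα'1 : p.α' ≤ 1
  /-- file A7: split `α_st + a_sep + ρ ≤ a_L`. -/
  hsplit₁ : p.αst + p.asep + p.ρ ≤ p.aL
  /-- file A7: split `α_st + ρ ≤ a_D`. -/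
  hsplit₂ : p.αst + p.ρ ≤ p.aD
  /-- file A7: split `α_st + α_c + ρ ≤ a_L`. -/
  hsplit₃ : p.αst + p.αc + p.ρ ≤ p.aL
  /-- file A7: located smallness `(θ₁+θ₂+θ₃)c₁(ρδ₀, α′) < 1`. -/
  hsmall : (p.θ₁ b M₂ + p.θ₂ + p.θ₃ b M₂) * B6.c1 p.d' (p.ρ * p.δ₀) p.α' < 1
  /-- file A4: `ε₀ ≥ 0`. -/
  hε₀ : 0 ≤ p.ε₀
  /-- file A4: `βₓ ≥ 0`. -/
  hβx : 0 ≤ p.βx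
  /-- file A4: `ρ_f ≥ 0`. -/
  hρf : 0 ≤ p.ρf
  /-- file A4: the rate budget `ρ_f + 2βₓε₀ ≤ δ`. -/
  hr : p.ρf + 2 * (p.βx * p.ε₀) ≤ p.δ
  /-- the common rate is below file A7's `δ_G`. -/
  hle_G : p.δ ≤ p.δG
  /-- the common rate is below file A7's output rate `(1−α′)ρδ₀`. -/
  hle_C : p.δ ≤ (1 - p.α') * (p.ρ * p.δ₀)

variable {p}

/-- `A₁G ≥ 0`. [cite: Balaban1985BackgroundPropagators, (3.90) p.410, bookkeeping] -/
theorem A₁G_nonneg {d ℓ : ℕ} {N : ℕ} {ι : Type} [Fintype ι] {b : Module.Basis ι ℝ (Matrix (Fin N) (Fin N) ℂ)} {M₂ : ℝ} (hp : p.Valid d ℓ b M₂) :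
    0 ≤ p.A₁G :=
  mul_nonneg (mul_nonneg (mul_nonneg hp.hNG hp.hBG₀) (c1_nonneg _ _ _)) (inv_factor_nonneg hp.hsmallG₁)

/-- `θtr ≥ 0`. [cite: Balaban1985BackgroundPropagators, (3.90) p.410, bookkeeping] -/
theorem θtr_nonneg {d ℓ : ℕ} {N : ℕ} {ι : Type} [Fintype ι] {b : Module.Basis ι ℝ (Matrix (Fin N) (Fin N) ℂ)} {M₂ : ℝ} (hp : p.Valid d ℓ b M₂) :
    0 ≤ p.θtr d b M₂ := by
  unfold θtr
  have := A₁G_nonneg hp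
  have := hp.hM₂
  have : 0 ≤ ∑ j, ‖b j‖ := Finset.sum_nonneg fun _ _ => norm_nonneg _
  have := hp.hα.le
  positivity

/-- `AD ≥ 0`. [cite: Balaban1985BackgroundPropagators, Thm 3.1 (3.42) p.397, bookkeeping] -/
theorem AD_nonneg {d ℓ : ℕ} {N : ℕ} {ι : Type} [Fintype ι] {b : Module.Basis ι ℝ (Matrix (Fin N) (Fin N) ℂ)} {M₂ : ℝ} (hp : p.Valid d ℓ b M₂) :
    0 ≤ p.AD d b M₂ :=
  mul_nonneg (mul_nonneg (mul_nonneg hp.hAE (c1_nonneg _ _ _)) (inv_factor_nonneg hp.hsmallG₁))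
    (add_nonneg zero_le_one (mul_nonneg (c1_nonneg _ _ _)
      (mul_nonneg (mul_nonneg (θtr_nonneg hp) (c1_nonneg _ _ _)) (inv_factor_nonneg hp.hsmallG₂))))

/-- `KC ≥ 0`. [cite: Balaban1985BackgroundPropagators, Thm 3.2 (3.48) p.398, bookkeeping] -/
theorem KC_nonneg {d ℓ : ℕ} {N : ℕ} {ι : Type} [Fintype ι] {b : Module.Basis ι ℝ (Matrix (Fin N) (Fin N) ℂ)} {M₂ : ℝ} (hp : p.Valid d ℓ b M₂) :
    0 ≤ p.KC b M₂ :=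
  mul_nonneg (mul_nonneg (mul_nonneg hp.hN hp.hB₀) (c1_nonneg _ _ _)) (inv_factor_nonneg hp.hsmall)

/-- **file A4's uniform constants `KnitConstants b M₂ ε₀ δ βₓ ρ_f A AD KC` hold under `Valid`.** [cite: Balaban1985BackgroundPropagators, Thm 3.1 (3.42) p.397, Thm 3.2 (3.48) p.398; Balaban1984PropagatorsII, (2.61)–(2.63) p.234] -/
theorem knitConstants_of_valid {d ℓ : ℕ} {N : ℕ} {ι : Type} [Fintype ι] {b : Module.Basis ι ℝ (Matrix (Fin N) (Fin N) ℂ)} {M₂ : ℝ}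
    (hp : p.Valid d ℓ b M₂) : KnitConstants b M₂ p.ε₀ p.δ p.βx p.ρf p.A (p.AD d b M₂) (p.KC b M₂) where
  hM₂ := hp.hM₂
  hrepr := hp.hrepr
  hA := hp.hA
  hA₁ := AD_nonneg hp
  hK := KC_nonneg hp
  hρ := hp.hρf
  hβ := hp.hβx
  hδ₀ := hp.hε₀
  hr := hp.hr

end KnitCubeParams

end Params

/-! ## §2 The per-(member, background) cube data: `KnitCubeInputs` -/

section Inputs

open scoped Matrix Matrix.Norms.L2Operator

variable {N : ℕ} (i : KIdx d ℓ hd hL b₀ b₁) (U : CfgY (Matrix (Fin N) (Fin N) ℂ) i)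
variable {ι : Type} [Fintype ι] (b : Module.Basis ι ℝ (Matrix (Fin N) (Fin N) ℂ))
variable [Fintype (geo9K i).Site] [DecidableEq (geo9K i).Site] (ιB : BlkY i → IBondY i) (Rr : ℝ) (Hp : Prop) (p : KnitCubeParams) (c s : ℝ)

/-- **THE CUBE DATA AT ONE MEMBER AND ONE BACKGROUND** — the inputs of junction files 15 ∕ 16 (M5.5: [4] Thm 3.7's cube expansion for `G′` at def-Y's letter of
record `parSymY`: an index type of cubes, supports `S_□`, `S′_□`, cube terms `T_□`, remainders `R_□`, (3.88) `Δ′_a(U; parSymY)·ΣT_□ = 1 − ΣR_□`, Cor.-3.6 block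
majorants of `conj b(η²T_□)` on `S_□`, (3.89) majorants of `conj b R_□` on `S′_□`, overlap counts, and for every direction `μ` the left entries `K_{E,□}^μ` of
`conj b(η⁻¹∇_{U,μ})·conj b(η²T_□)` summing to `A_E·ℓ·e^{−δ₀d}`) and of file A7 (M5.6: [4] Thm 3.9's per-cube data at print's transporters `parKnitY` — cube
letters `G′_□ = Oc □`, cut-offs `h_□`, `χ_□`, supports, local inverses `C_□ = Cl □` with the local inverse property `hloc`, per-cube (3.48) blocks `hC`,
[2]-difference majorants `hD`, site majorants `hGc` of the cube letters, separation, slow variation), the member's section `ιB` of the carrier-block map, its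
scale `c_f = Lᵏ`, the unit `η_S⁴s = 1`, the row sum `c` at the final rate, and the [4] §2 geometry of the member's block set at the rates used ((2.54),
`d(y,y) = 0`, symmetry, `d ≥ 0`, (2.61) ∕ (2.63) instances, scale transfers of `ℓ²` and `ℓ⁻⁴`).  A hypothesis SHAPE: every field displayed, inhabited by nothing
here (suppliers: M5.1b∕c, M5.2, M5.4, M5.5, M5.6 of sub-row G-B9-LETTERS and the def-Y geometry).
[cite: Balaban1985BackgroundPropagators, Thm 3.7 (3.87)–(3.90) pp.409–410, Cor 3.6 p.408, Thm 3.9 p.413, (3.95)–(3.96) p.411, Thm 3.1 (3.42) p.397, Thm 3.2 (3.48) p.398, (3.19) p.393, (3.24)–(3.25) p.394; Balaban1984PropagatorsII, (2.52)–(2.54) p.232, Lemma 2.1 (2.61)–(2.63) p.234, (2.83)–(2.85) p.237] -/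
structure KnitCubeInputs : Type 1 where
  /-- the section `ιB` of the carrier-block map `β`. -/
  hι : ∀ t, B6Ineq2142KLevelV1.β i.hN i.D i.hk (ιB t) = t
  /-- print's units `c_f = Lᵏ`. -/
  hcf : i.cf = (((ℓ + 1 : ℕ) : ℝ)) ^ i.k
  /-- the unit of `C`: `η_S⁴·s = 1`. -/
  hs : (etaS i ^ 2 * etaS i ^ 2) * s = 1
  /-- [4] (2.54). -/
  htri : Triangle254 (toB6 (geo9K i) Rr Hp)
  /-- `d(y,y) = 0`. -/
  hrefl : ∀ y : (geo9K i).Site, (geo9K i).dist y y = 0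
  /-- symmetry of `d`. -/
  hsymm : ∀ a a' : (geo9K i).Site, (geo9K i).dist a a' = (geo9K i).dist a' a
  /-- `d ≥ 0`. -/
  hdnn : ∀ a a' : (geo9K i).Site, 0 ≤ (geo9K i).dist a a'
  /-- the row sum at the final rate `ρ_f`. -/
  hrow : ∀ a : (geo9K i).Site, ∑ a' : (geo9K i).Site, Real.exp (-(p.ρf * (geo9K i).dist a a')) ≤ c
  /-- (2.61) at `(ε₀, βₓ)` (final resummation, file A4). -/
  h261f : Ineq261 p.d₁ (toB6 (geo9K i) Rr Hp) p.ε₀ p.βx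
  -- M5.5: Theorem 3.7's cube data at the letter of record
  /-- the index type of M5.5's cubes. -/
  κ : Type
  /-- it is finite. -/
  [instκ : Fintype κ]
  /-- supports of the cube terms. -/
  SG : κ → Finset (geo9K i).Site
  /-- supports of the remainders. -/
  SG' : κ → Finset (geo9K i).Site
  /-- the cube terms `T_□` (realified later by `conj b`). -/
  T : κ → Module.End ℝ (SiteY i → Matrix (Fin N) (Fin N) ℂ)
  /-- the remainders `R_□`. -/
  R : κ → Module.End ℝ (SiteY i → Matrix (Fin N) (Fin N) ℂ)
  /-- the left-entry block majorants `K_{E,□}^μ`. -/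
  KE : Fin (d + 1) → κ → (geo9K i).Site → (geo9K i).Site → ℝ
  /-- (2.61) at `(δ₀, α₁)`. -/
  h261G₁ : Ineq261 p.dG₁ (toB6 (geo9K i) Rr Hp) p.δG₀ p.αG₁
  /-- (2.63) at `(δ₀, α₁)`. -/
  h263G₁ : Ineq263 p.dG₁ (toB6 (geo9K i) Rr Hp) p.δG₀ p.αG₁
  /-- Cor. 3.6 block majorants of the cube terms. -/
  hT : ∀ k, HasMajorant (g := toB6 (geo9K i) Rr Hp) (fun q : SiteY i × ι => ιB (blkOf i.D.toDomains q.1)) (conj b ((etaS i ^ 2) • T k))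
    (fun a a' => if a ∈ SG k then p.BG₀ * (geo9K i).len a ^ 2 * Real.exp (-(p.δG₀ * (geo9K i).dist a a')) else 0)
  /-- overlap count of the cube supports. -/
  hcntG : ∀ a : (geo9K i).Site, (∑ k, if a ∈ SG k then (1 : ℝ) else 0) ≤ p.NG
  /-- the left entries of the cube terms, every direction. -/
  hTE : ∀ (μ : Fin (d + 1)) k, HasMajorant (g := toB6 (geo9K i) Rr Hp) (fun q : SiteY i × ι => ιB (blkOf i.D.toDomains q.1))
    (conj b (diffLetter (shiftY i) (UboxY i U) ((((etaS i : ℝ) : ℂ))⁻¹) (Sum.inl μ)) * conj b ((etaS i ^ 2) • T k)) (KE μ k)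
  /-- their sum is a (3.42)₂-shape majorant. -/
  hKE : ∀ (μ : Fin (d + 1)) a a', (∑ k, KE μ k a a') ≤ p.AE * (geo9K i).len a * Real.exp (-(p.δG₀ * (geo9K i).dist a a'))
  /-- (3.89) majorants of the remainders. -/
  h389 : ∀ k, HasMajorant (g := toB6 (geo9K i) Rr Hp) (fun q : SiteY i × ι => ιB (blkOf i.D.toDomains q.1)) (conj b (R k))
    (fun a a' => if a ∈ SG' k then p.θG * Real.exp (-(p.δG₀ * (geo9K i).dist a a')) else 0)
  /-- overlap count of the remainder supports. -/
  hcntG' : ∀ a : (geo9K i).Site, (∑ k, if a ∈ SG' k then (1 : ℝ) else 0) ≤ p.NG'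
  /-- (3.88): `Δ′_a(U; parSymY)·ΣT_□ = 1 − ΣR_□`. -/
  h388 : (deltaPrimeAY i (parSymY i) U).restrictScalars ℝ * (∑ k, T k) = 1 - ∑ k, R k
  /-- (2.61) at `((1−α₁)δ₀, α₂)` (transfer). -/
  h261G₂ : Ineq261 p.dG₂ (toB6 (geo9K i) Rr Hp) ((1 - p.αG₁) * p.δG₀) p.αG₂
  /-- (2.63) at `((1−α₁)δ₀, α₂)` (transfer). -/
  h263G₂ : Ineq263 p.dG₂ (toB6 (geo9K i) Rr Hp) ((1 - p.αG₁) * p.δG₀) p.αG₂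
  -- M5.6: Theorem 3.9's per-cube data at print's transporters (file A7's list)
  /-- the index type of M5.6's cubes. -/
  κι : Type
  /-- it is finite. -/
  [instκι : Fintype κι]
  /-- the cube letters `G′_□(·)`. -/
  Oc : κι → SiteOpY (Matrix (Fin N) (Fin N) ℂ) i
  /-- the `χ_□ = 1` cores. -/
  Sχ : κι → Finset (geo9K i).Site
  /-- the supports of `h_□`. -/
  Sk : κι → Finset (geo9K i).Site
  /-- the cut-offs `χ_□`. -/
  χ : κι → BlkY i → ℝ
  /-- the partition of unity `h_□`. -/
  h : κι → BlkY i → ℝ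
  /-- the local inverses `C_□`. -/
  Cl : κι → Module.End ℝ (BlkY i → Matrix (Fin N) (Fin N) ℂ)
  /-- scale transfer of `ℓ²` at `α_G`. -/
  hSTG : B9Ineq347.ScaleTransfer (geo9K i) p.δG p.αG p.CG (fun a => (geo9K i).len a ^ 2)
  /-- (2.61) at `((1−α_G)δ_G, α₂)`. -/
  h261Gw : Ineq261 p.d₂ (toB6 (geo9K i) Rr Hp) ((1 - p.αG) * p.δG) p.α₂
  /-- (3.42)₁-shape site majorants of the cube letters at the common amplitude∕rate. -/
  hGc : ∀ k, HasMajorant (g := toB6 (geo9K i) Rr Hp) (fun q : SiteY i × ι => ιB (blkOf i.D.toDomains q.1))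
    (conj b ((etaS i ^ 2) • (Oc k U).restrictScalars ℝ)) (fun a a' => p.A * (geo9K i).len a ^ 2 * Real.exp (-(p.δG * (geo9K i).dist a a')))
  /-- scale transfer of `ℓ⁻⁴` at `α_st`. -/
  hST : B9Ineq347.ScaleTransfer (geo9K i) p.δ₀ p.αst p.C (fun a => ((geo9K i).len a ^ 4)⁻¹)
  /-- (2.61) at `(δ₀, b − ρ)`. -/
  h261b : Ineq261 p.d' (toB6 (geo9K i) Rr Hp) p.δ₀ (p.bb - p.ρ)
  /-- (2.61) at `(ρδ₀, α′)`. -/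
  h261 : Ineq261 p.d' (toB6 (geo9K i) Rr Hp) (p.ρ * p.δ₀) p.α'
  /-- (2.63) at `(ρδ₀, α′)`. -/
  h263 : Ineq263 p.d' (toB6 (geo9K i) Rr Hp) (p.ρ * p.δ₀) p.α'
  /-- `Σ_□ h_□² = 1`. -/
  hsq : ∀ t, ∑ k, h k t ^ 2 = 1
  /-- `|h_□| ≤ 1`. -/
  hh : ∀ k t, |h k t| ≤ 1
  /-- `supp h_□ ⊂ S_□`. -/
  hS : ∀ k t, h k t ≠ 0 → ιB t ∈ Sk k
  /-- overlap count of M5.6's cover. -/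
  hcnt : ∀ a : (geo9K i).Site, (∑ k, if a ∈ Sk k then (1 : ℝ) else 0) ≤ p.Nn
  /-- `0 ≤ χ_□ ≤ 1`. -/
  hχ01 : ∀ k t, 0 ≤ χ k t ∧ χ k t ≤ 1
  /-- `χ_□ = 1` on the core. -/
  hχS : ∀ k t, ιB t ∈ Sχ k → χ k t = 1
  /-- separation of the core's complement from `supp h_□`. -/
  hsep : ∀ k a, a ∉ Sχ k → ∀ a'' ∈ Sk k, p.Dsep ≤ (geo9K i).dist a a''
  /-- slow variation of `h_□`. -/
  hLip : ∀ k (t t' : BlkY i), |h k t' - h k t| ≤ p.ℓ₀ + p.ℓ₁ * (geo9K i).dist (ιB t) (ιB t')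
  /-- the local inverse property (M5.2-E). -/
  hloc : ∀ k, (cutMulY (𝔸 := Matrix (Fin N) (Fin N) ℂ) (h k)).restrictScalars ℝ *
    ((cutMulY (𝔸 := Matrix (Fin N) (Fin N) ℂ) (χ k)).restrictScalars ℝ * (XY i (parKnitY i) (Oc k) U).restrictScalars ℝ) * Cl k *
      (cutMulY (𝔸 := Matrix (Fin N) (Fin N) ℂ) (h k)).restrictScalars ℝ =
    (cutMulY (𝔸 := Matrix (Fin N) (Fin N) ℂ) (h k)).restrictScalars ℝ * (cutMulY (𝔸 := Matrix (Fin N) (Fin N) ℂ) (h k)).restrictScalars ℝ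
  /-- the per-cube (3.48) blocks of `C_□`. -/
  hC : ∀ k, HasMajorant (g := toB6 (geo9K i) Rr Hp) (fun q : BlkY i × ι => ιB q.1) (conj b (s • Cl k))
    (fun a a' => if a ∈ Sk k then p.B₀ * ((geo9K i).len a ^ 4)⁻¹ * Real.exp (-(p.bb * p.δ₀ * (geo9K i).dist a a')) else 0)
  /-- the [2]-difference majorants (GAP G-B9-05). -/
  hD : ∀ k, HasMajorant (g := toB6 (geo9K i) Rr Hp) (fun q : BlkY i × ι => ιB q.1)
    (conj b ((etaS i ^ 2 * etaS i ^ 2) • ((XY i (parKnitY i) (GpY i (parKnitY i)) U).restrictScalars ℝ - (XY i (parKnitY i) (Oc k) U).restrictScalars ℝ)))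
    (fun a a'' => p.κD * Real.exp (-(2 * p.δ₀ * p.Dsep)) * (geo9K i).len a ^ 4 * Real.exp (-(p.aD * p.δ₀ * (geo9K i).dist a a'')))

end Inputs

/-! ## §3 ★★★ `KnitMajorants` from the cube data -/

section Main

open scoped Matrix Matrix.Norms.L2Operator
open KnitCubeParams (A₁G_nonneg θtr_nonneg AD_nonneg KC_nonneg)

variable {N : ℕ} {G : Subgroup (Matrix (Fin N) (Fin N) ℂ)ˣ} (i : KIdx d ℓ hd hL b₀ b₁)
variable {ι : Type} [Fintype ι] [DecidableEq ι] (b : Module.Basis ι ℝ (Matrix (Fin N) (Fin N) ℂ))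
variable [Fintype (geo9K i).Site] [DecidableEq (geo9K i).Site] (ιB : BlkY i → IBondY i) {Rr : ℝ} {Hp : Prop}

/-- ★★★ **FILE A4's MAJORANT PACKAGE AT ONE MEMBER AND ONE BACKGROUND FROM THE CUBE DATA** (junction files 15, 16 and file A7 composed; rate∕amplitude weakening
`hasMajorant_mono`).  Inputs: `G ≤ U(N)` averaging-closed, `N ≥ 1`, a `G`-valued `U` with `G`-valued knit legs whose lift satisfies [Balaban1985Averaging] (52) at the
member's finest scale, `pdev (liftCfg U) < α₀′L^{−2k}`; valid scalars `p.Valid d ℓ b M₂`; the cube data `KnitCubeInputs i U b ιB Rr Hp p c s`.  Output: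
`KnitMajorants i U b ιB Rr Hp p.d₁ p.ε₀ p.δ p.βₓ p.ρ_f p.A (p.AD d b M₂) (p.KC b M₂) c s` — (3.42)₁ for `η_S²G′(U; parKnitY)`, (3.42)₂ for `η_S⁻¹∇_μ·η_S²G′`, (3.48) for
`s·(Q′G′²Q′*)⁻¹`, all at print's transporters.  No estimate proved; the cube data are displayed; the Yang–Mills mass gap is NOT proved.
[cite: Balaban1985BackgroundPropagators, Thm 3.1 (3.42) p.397, Thm 3.2 (3.48) p.398, Thm 3.7 (3.87)–(3.90) pp.409–410, Thm 3.9 p.413, (3.95)–(3.96) p.411, (3.19) p.393; Balaban1984PropagatorsII, Lemma 2.1 (2.61) p.234, Prop 2.2 (2.64)–(2.67) p.234, (2.83) p.237; Balaban1985Averaging, Prop. 2 p.26] -/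
theorem knitMajorants_of_cubes [Nonempty (Fin N)] (hG : G ≤ B7Prop2Explicit.unitaryUnits (Matrix (Fin N) (Fin N) ℂ))
    (hGa : AvgClosed (d + 1) (ℓ + 1) G) {U : CfgY (Matrix (Fin N) (Fin N) ℂ) i} (hU : ∀ μ x, U μ x ∈ G)
    (hpar : ∀ z w : SiteY i, parKnitY i U z w ∈ G) {p : KnitCubeParams} {M₂ : ℝ} (hp : p.Valid d ℓ b M₂)
    (h52 : pdev (liftCfg U) < p.α₀' * ((((ℓ + 1 : ℕ) : ℝ) ^ i.k)⁻¹) ^ 2) {c s : ℝ} (inp : KnitCubeInputs i U b ιB Rr Hp p c s) :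
    KnitMajorants i U b ιB Rr Hp p.d₁ p.ε₀ p.δ p.βx p.ρf p.A (p.AD d b M₂) (p.KC b M₂) c s := by
  letI : Fintype inp.κ := inp.instκ
  letI : Fintype inp.κι := inp.instκι
  have hlen0 : ∀ a : (geo9K i).Site, 0 ≤ (geo9K i).len a := fun a => by
    rw [geo9K_len_kGeo]; exact (len_pos i a).le
  -- junction file 15: the (3.42)₁ majorant of `η_S²G′(U; parKnitY)` from M5.5's cube data
  have hGm₀ := hasMajorant_conj_GpY_parKnitY_of_cubes i b ιB hG hGa hU hp.hα hp.hα3 hp.hα2 h52 inp.hcf hp.hM₂ hp.hrepr inp.htri inp.hrefl inp.hdnn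
    p.dG₁ inp.SG inp.SG' inp.T inp.R hp.hBG₀ hp.hθG hp.hNG hp.hNG' hp.hαδ₁ inp.h261G₁ inp.h263G₁ hp.hsmallG₁ inp.hT inp.hcntG inp.h389 inp.hcntG'
    inp.h388 p.dG₂ hp.hαδ₂ inp.h261G₂ inp.h263G₂ hp.hsmallG₂
  -- junction file 16: the (3.42)₂ majorants, left factor `conj b(η_S⁻¹∇_{U,μ})`, weight `ℓ`
  have hDG : ∀ μ : Fin (d + 1), HasMajorant (g := toB6 (geo9K i) Rr Hp) (fun q : SiteY i × ι => ιB (blkOf i.D.toDomains q.1))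
      (conj b (diffLetter (shiftY i) (UboxY i U) ((((etaS i : ℝ) : ℂ))⁻¹) (Sum.inl μ)) * conj b ((etaS i ^ 2) • (GpY i (parKnitY i) U).restrictScalars ℝ))
      (fun a a' => p.AD d b M₂ * (geo9K i).len a * Real.exp (-(p.rG * (geo9K i).dist a a'))) := fun μ =>
    hasMajorant_left_conj_GpY_parKnitY_of_cubes i b ιB hG hGa hU hp.hα hp.hα3 hp.hα2 h52 inp.hcf hp.hM₂ hp.hrepr inp.htri inp.hrefl inp.hdnn p.dG₁
      inp.SG inp.SG' inp.T inp.R (conj b (diffLetter (shiftY i) (UboxY i U) ((((etaS i : ℝ) : ℂ))⁻¹) (Sum.inl μ))) (fun a => (geo9K i).len a) (inp.KE μ)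
      hp.hBG₀ hp.hθG hp.hNG hp.hNG' hp.hAE hlen0 hp.hαδ₁ inp.h261G₁ inp.h263G₁ hp.hsmallG₁ inp.hT inp.hcntG (inp.hTE μ) (inp.hKE μ) inp.h389 inp.hcntG'
      inp.h388 p.dG₂ hp.hαδ₂ hp.hαδ₂' inp.h261G₂ inp.h263G₂ hp.hsmallG₂
  -- weakening of file 15's output to file A7's common amplitude `A` and rate `δ_G`
  have hwk : ∀ {δ' δ'' : ℝ}, δ'' ≤ δ' → ∀ a a' : (geo9K i).Site,
      Real.exp (-(δ' * (geo9K i).dist a a')) ≤ Real.exp (-(δ'' * (geo9K i).dist a a')) := fun hδ a a' =>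
    Real.exp_le_exp.2 (neg_le_neg (mul_le_mul_of_nonneg_right hδ (inp.hdnn a a')))
  have hGm : HasMajorant (g := toB6 (geo9K i) Rr Hp) (fun q : SiteY i × ι => ιB (blkOf i.D.toDomains q.1))
      (conj b ((etaS i ^ 2) • (GpY i (parKnitY i) U).restrictScalars ℝ))
      (fun a a' => p.A * (geo9K i).len a ^ 2 * Real.exp (-(p.δG * (geo9K i).dist a a'))) := by
    refine hasMajorant_mono (g := toB6 (geo9K i) Rr Hp) _ hGm₀ fun a a' => ?_
    calc p.AG d b M₂ * (geo9K i).len a ^ 2 * Real.exp (-(p.rG * (geo9K i).dist a a'))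
        ≤ p.A * (geo9K i).len a ^ 2 * Real.exp (-(p.rG * (geo9K i).dist a a')) :=
          mul_le_mul_of_nonneg_right (mul_le_mul_of_nonneg_right hp.hAG (sq_nonneg _)) (Real.exp_pos _).le
      _ ≤ p.A * (geo9K i).len a ^ 2 * Real.exp (-(p.δG * (geo9K i).dist a a')) :=
          mul_le_mul_of_nonneg_left (hwk hp.hδGr a a') (mul_nonneg hp.hA (sq_nonneg _))
  -- file A7 (junction file 20 + rate weakening)
  exact knitMajorants_of_site i b ιB hG hU hpar inp.hι inp.hcf inp.Oc hp.hM₂ hp.hrepr p.d' p.d₂ hp.hA (AD_nonneg hp) hp.hCG hp.hαGδ hp.hα₂0 hp.hα₂1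
    hp.hδG inp.hSTG inp.h261Gw hGm hDG inp.hGc hp.hrate inp.Sχ inp.Sk inp.χ inp.h inp.Cl inp.hs hp.hκD hp.hℓ₀ hp.hℓ₁ hp.hB₀ hp.hC0 hp.hN hp.hδ₀
    hp.hasep hp.hρ hp.hρb hp.hαc hp.hα'1 hp.hsplit₁ hp.hsplit₂ hp.hsplit₃ rfl rfl rfl rfl inp.htri inp.hrefl inp.hsymm inp.hdnn inp.hST inp.h261b
    inp.h261 inp.h263 hp.hsmall inp.hsq inp.hh inp.hS inp.hcnt inp.hχ01 inp.hχS inp.hsep inp.hLip inp.hloc inp.hC inp.hD inp.h261f inp.hrow hp.hle_G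
    (hp.hle_G.trans hp.hδGr) hp.hle_C

end Main

end Literature.MathematicalPhysics.QuantumFieldTheory.Balaban1983to89.B8Thm2TorusKnitMajorantsOfCubes

end
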